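import Summits.QuantumAdvantage.QuantumAdvantage.Theorems.SosSandwichTransferPBDescent
import HarnessLib

/-!
# Crux `TransferPB` (stmt-QuantumAdvantage-15238, route SosSandwich), line `birth` — the live levels of the descent are polynomially small

Round-budget half of the implementation statement (M_desc) of `Theorems/SosSandwichTransferPBDescent.lean`: a
transcript machine running the heavy-prefix descent (`Theorems/SosSandwichTransferPBDescentDefs.lean`) asks,
per round, one BLOCK query per child of a live prefix and one SINGLE query per live prefix. Under an answer
function `g` CONSISTENT with the node-test promise problem (NO instances answered `false`) every live prefix
`u` has block magnitude `M_u(ρ) > w/2`; distinct prefixes of one length have disjoint blocks and the total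
averaged BBBV magnitude after any path is `≤ 4T²`, so:

* `liveLevel_nodup` — the levels have no duplicates; `length_descentCands_le`;
* `sum_bbbvMag_le` — `Σ_s m_s(ρ) ≤ 4T²` after ANY path `ρ` (pointwise in the completion);
* `sum_blockMag_le` — `Σ_{u ∈ L} M_u(ρ) ≤ Σ_s m_s(ρ)` for distinct `u` of one length;
* **`length_liveLevel_mul_le`** / `length_liveLevel_le` — `#liveLevel_j · (w/2) ≤ 4T²`, i.e. `≤ 8T²/w` live
  prefixes per level; `length_descentCands_le_of_consistent` — `≤ W · 8T²/w` candidates;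
* `liveBound_eq` — `8T²/w` is the natural number `8T² · 2^k · (400 · d · (r(n)+1))^c` (`d = thm23Degree F x`),
  an explicit polynomial expression for the machine's round budget.

All proved. Sources: C. H. Bennett, E. Bernstein, G. Brassard, U. Vazirani, SIAM J. Comput. 26 (1997),
Cor. 3.4 (proof: heavy strings are few); S. Aaronson, A. Ambainis, Theory Comput. 10 (2014), proof of Thm. 23.
-/

-- D-0017: single-conjunct summit ⇒ the duplicate `QuantumAdvantage.QuantumAdvantage` is mandated.
set_option linter.dupNamespace false

noncomputable section

namespace Summit.QuantumAdvantage.QuantumAdvantage.Cruxes.TransferPB.Birth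

open Finset MeasureTheory Literature.Computability.Cryptography Literature.Computability.Complexity
  Literature.Computability.QuantumComplexity Literature.Computability.QuantumComplexity.ClassicalSimulation
open Summit.QuantumAdvantage.QuantumAdvantage.Theses.SosSandwich
open scoped ENNReal

namespace SimTreePB

section Nodup

variable {blk sgl : List Bool → Bool}

/-- The live levels have no duplicates. [folklore] -/
theorem liveLevel_nodup : ∀ j : ℕ, (liveLevel blk j).Nodup
  | 0 => by
    unfold liveLevel
    split_ifs <;> simp
  | j + 1 => by
    unfold liveLevel
    rw [List.nodup_flatMap]
    refine ⟨fun u _ => List.Nodup.filter _ (by simp), ?_⟩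
    refine (liveLevel_nodup j).pairwise_of_forall_ne fun u hu v hv huv => ?_
    simp only [Function.onFun]
    rw [List.disjoint_left]
    intro w hwu hwv
    simp only [List.mem_filter, List.mem_cons, List.not_mem_nil, or_false] at hwu hwv
    obtain ⟨hwu, -⟩ := hwu
    obtain ⟨hwv, -⟩ := hwv
    have key : ∀ (a b : List Bool) (c d : Bool), a ++ [c] = b ++ [d] → a = b := fun a b c d h =>
      (List.append_inj' h rfl).1
    apply huv
    rcases hwu with rfl | rfl <;> rcases hwv with h | h <;> exact key _ _ _ _ h

/-- Hence the length of a live level is the cardinality of its set of strings. [folklore] -/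
theorem length_liveLevel_eq_card (j : ℕ) : (liveLevel blk j).length = (liveLevel blk j).toFinset.card :=
  (List.toFinset_card_of_nodup (liveLevel_nodup j)).symm

/-- Length of a level-wise concatenation. [folklore] -/
theorem length_flatMap_range (f : ℕ → List (List Bool)) :
    ∀ W : ℕ, ((List.range W).flatMap f).length = ∑ j ∈ Finset.range W, (f j).length
  | 0 => by simp
  | W + 1 => by
    rw [List.range_succ, List.flatMap_append, List.length_append, Finset.sum_range_succ,
      length_flatMap_range f W]
    simp

/-- The candidate list is no longer than all live levels together. [folklore] -/
theorem length_descentCands_le (W : ℕ) (used : List (List Bool)) :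
    (descentCands blk sgl W used).length ≤ ∑ j ∈ Finset.range W, (liveLevel blk j).length := by
  unfold descentCands
  rw [← length_flatMap_range]
  exact List.length_filter_le _ _

end Nodup

section Magnitude

variable (F : QCircuitFamily cliffordT) (x : List Bool)

/-- **Total averaged BBBV magnitude after any path is `≤ 4T²`** (pointwise in the completion `y`: the strings'
query magnitudes of a unit-norm run sum to `≤ T`). [cite: BennettBernsteinBrassardVazirani1997, Cor. 3.4 (proof)] -/
theorem sum_bbbvMag_le (ρ : List (Fin (numOracleBits F x) × Bool)) :
    ∑ s : Fin (numOracleBits F x), bbbvMag F x ρ s ≤ 4 * ((F.circ x.length).oracleQueries : ℝ) ^ 2 := by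
  set T : ℕ := (F.circ x.length).oracleQueries with hT
  set gs := (F.circ x.length).gates with hgs
  set ψ0 : QReg (x.length + F.ancillas x.length) → ℂ := basisState (padInput x.get (F.ancillas x.length))
    with hψ0
  have hC : (⟨gs⟩ : QCircuit cliffordT (x.length + F.ancillas x.length)) = F.circ x.length := rfl
  -- pointwise in the oracle point `z`: the sum over the relevant bits is a sum over the short strings, `≤ T`
  have hpt : ∀ z : Fin (numOracleBits F x) → Bool,
      ∑ s : Fin (numOracleBits F x),
          (queryWeights (oracleOf F x z) ({((bitEquiv F x).symm s).1} : Set (List Bool)) gs ψ0).sum ≤ T := by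
    intro z
    have hre : ∑ s : Fin (numOracleBits F x),
        (queryWeights (oracleOf F x z) ({((bitEquiv F x).symm s).1} : Set (List Bool)) gs ψ0).sum =
        ∑ u : OracleVar (oracleWidth F x),
          (queryWeights (oracleOf F x z) ({u.1} : Set (List Bool)) gs ψ0).sum :=
      Equiv.sum_comp (bitEquiv F x).symm
        (fun u : OracleVar (oracleWidth F x) => (queryWeights (oracleOf F x z) ({u.1} : Set (List Bool)) gs ψ0).sum)
    rw [hre, Finset.sum_coe_sort (shortStrings (oracleWidth F x))
      (fun q => (queryWeights (oracleOf F x z) ({q} : Set (List Bool)) gs ψ0).sum)]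
    have h := sum_sum_queryWeights_le cliffordT_isUnitary_holds (oracleOf F x z) (shortStrings (oracleWidth F x)) gs ψ0
    rw [hC, hψ0, normSq_basisState, mul_one] at h
    rw [hψ0]
    exact h
  have hTnn : (0 : ℝ) ≤ 4 * (T : ℝ) := by positivity
  unfold bbbvMag
  calc ∑ s : Fin (numOracleBits F x), boolAvg (fun y : Fin (numOracleBits F x) → Bool => 4 * (T : ℝ) *
          (queryWeights (oracleOf F x (ρ.foldr (fun ib z => Function.update z ib.1 ib.2) y))
            ({((bitEquiv F x).symm s).1} : Set (List Bool)) gs ψ0).sum)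
      = boolAvg (fun y : Fin (numOracleBits F x) → Bool => 4 * (T : ℝ) * ∑ s : Fin (numOracleBits F x),
          (queryWeights (oracleOf F x (ρ.foldr (fun ib z => Function.update z ib.1 ib.2) y))
            ({((bitEquiv F x).symm s).1} : Set (List Bool)) gs ψ0).sum) := by
        unfold boolAvg
        rw [← Finset.sum_div]
        congr 1
        rw [Finset.sum_comm]
        refine Finset.sum_congr rfl fun y _ => ?_
        simp only [Finset.mul_sum]
    _ ≤ boolAvg (fun _ : Fin (numOracleBits F x) → Bool => 4 * (T : ℝ) * T) := by
        unfold boolAvg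
        exact div_le_div_of_nonneg_right
          (Finset.sum_le_sum fun y _ => mul_le_mul_of_nonneg_left (hpt _) hTnn) (by positivity)
    _ = 4 * (T : ℝ) ^ 2 := by rw [boolAvg_const]; ring

/-- **Block magnitudes of distinct prefixes of one length add up to at most the total** (a string has at most
one prefix of each length). [cite: BennettBernsteinBrassardVazirani1997, Cor. 3.4] -/
theorem sum_blockMag_le (ρ : List (Fin (numOracleBits F x) × Bool)) {L : Finset (List Bool)} {j : ℕ}
    (hL : ∀ u ∈ L, u.length = j) :
    ∑ u ∈ L, blockMag F x ρ u ≤ ∑ s : Fin (numOracleBits F x), bbbvMag F x ρ s := by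
  classical
  unfold blockMag
  have hdisj : (L : Set (List Bool)).PairwiseDisjoint fun u =>
      univ.filter fun s : Fin (numOracleBits F x) => u <+: bitString F x s := by
    intro u hu v hv huv
    simp only [Function.onFun]
    rw [Finset.disjoint_left]
    intro s hsu hsv
    rw [mem_filter] at hsu hsv
    apply huv
    rw [List.prefix_iff_eq_take] at hsu hsv
    rw [hsu.2, hsv.2, hL u hu, hL v hv]
  rw [← Finset.sum_biUnion hdisj]
  exact Finset.sum_le_sum_of_subset_of_nonneg (subset_univ _) fun s _ _ => bbbvMag_nonneg F x ρ s

end Magnitude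

section LiveBound

variable {F : QCircuitFamily cliffordT} {x : List Bool} {r : Polynomial ℕ} {c k : ℕ} {g : List Bool → Bool}

/-- A light block is answered `false`. [folklore] -/
theorem answer_block_false' (hgn : ∀ v ∈ (nodeProblem F r c k).no, g v = false)
    {ρ : List (Fin (numOracleBits F x) × Bool)} {u : List Bool}
    (h : blockMag F x ρ u ≤ pbThreshold F x r c k / 2) : g (encBlock F x ρ u) = false :=
  hgn _ ⟨x, ρ, Or.inl ⟨u, rfl, h⟩⟩

/-- A block answered `true` by a consistent `g` is heavier than `w/2`. [folklore] -/
theorem halfThreshold_lt_blockMag (hgn : ∀ v ∈ (nodeProblem F r c k).no, g v = false)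
    {ρ : List (Fin (numOracleBits F x) × Bool)} {u : List Bool} (h : g (encBlock F x ρ u) = true) :
    pbThreshold F x r c k / 2 < blockMag F x ρ u := by
  by_contra hle
  have := answer_block_false' hgn (not_lt.1 hle)
  rw [h] at this
  exact Bool.noConfusion this

/-- **The live levels are polynomially small under consistency**: `#liveLevel_j · (w/2) ≤ 4T²`, i.e. at most
`8T²/w` live prefixes per level (BBBV: heavy strings are few). [cite: BennettBernsteinBrassardVazirani1997, Cor. 3.4] -/
theorem length_liveLevel_mul_le (hgn : ∀ v ∈ (nodeProblem F r c k).no, g v = false)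
    (ρ : List (Fin (numOracleBits F x) × Bool)) (j : ℕ) :
    ((liveLevel (fun u => g (encBlock F x ρ u)) j).length : ℝ) * (pbThreshold F x r c k / 2) ≤
      4 * ((F.circ x.length).oracleQueries : ℝ) ^ 2 := by
  classical
  set blk : List Bool → Bool := fun u => g (encBlock F x ρ u) with hblk
  set L := (liveLevel blk j).toFinset with hLdef
  have hlen : (liveLevel blk j).length = L.card := length_liveLevel_eq_card j
  rw [hlen]
  have h1 : ((L.card : ℕ) : ℝ) * (pbThreshold F x r c k / 2) ≤ ∑ u ∈ L, blockMag F x ρ u := by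
    rw [← nsmul_eq_mul, ← Finset.sum_const]
    refine Finset.sum_le_sum fun u hu => ?_
    have hb : blk u = true := blk_of_mem_liveLevel (List.mem_toFinset.1 hu)
    have hb' : g (encBlock F x ρ u) = true := by simpa only [hblk] using hb
    exact (halfThreshold_lt_blockMag hgn hb').le
  have h2 : ∑ u ∈ L, blockMag F x ρ u ≤ ∑ s : Fin (numOracleBits F x), bbbvMag F x ρ s :=
    sum_blockMag_le F x ρ fun u hu => length_of_mem_liveLevel (List.mem_toFinset.1 hu)
  exact h1.trans (h2.trans (sum_bbbvMag_le F x ρ))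

/-- The same as a bound on the length: `#liveLevel_j ≤ 8T²/w`. [cite: BennettBernsteinBrassardVazirani1997, Cor. 3.4] -/
theorem length_liveLevel_le (hgn : ∀ v ∈ (nodeProblem F r c k).no, g v = false)
    (ρ : List (Fin (numOracleBits F x) × Bool)) (j : ℕ) :
    ((liveLevel (fun u => g (encBlock F x ρ u)) j).length : ℝ) ≤
      8 * ((F.circ x.length).oracleQueries : ℝ) ^ 2 / pbThreshold F x r c k := by
  have hw := pbThreshold_pos F x r c k
  rw [le_div_iff₀ hw]
  have := length_liveLevel_mul_le hgn ρ j
  linarith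

/-- **The candidate list is polynomially small under consistency**: at most `W · 8T²/w` candidates.
[cite: BennettBernsteinBrassardVazirani1997, Cor. 3.4] -/
theorem length_descentCands_le_of_consistent (hgn : ∀ v ∈ (nodeProblem F r c k).no, g v = false)
    (ρ : List (Fin (numOracleBits F x) × Bool)) (sgl : List Bool → Bool) (W : ℕ) (used : List (List Bool)) :
    ((descentCands (fun u => g (encBlock F x ρ u)) sgl W used).length : ℝ) ≤
      W * (8 * ((F.circ x.length).oracleQueries : ℝ) ^ 2 / pbThreshold F x r c k) := by
  calc ((descentCands (fun u => g (encBlock F x ρ u)) sgl W used).length : ℝ)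
      ≤ ((∑ j ∈ Finset.range W, (liveLevel (fun u => g (encBlock F x ρ u)) j).length : ℕ) : ℝ) := by
        exact_mod_cast length_descentCands_le W used
    _ = ∑ j ∈ Finset.range W, ((liveLevel (fun u => g (encBlock F x ρ u)) j).length : ℝ) := by push_cast; rfl
    _ ≤ ∑ _j ∈ Finset.range W, 8 * ((F.circ x.length).oracleQueries : ℝ) ^ 2 / pbThreshold F x r c k :=
        Finset.sum_le_sum fun j _ => length_liveLevel_le hgn ρ j
    _ = W * (8 * ((F.circ x.length).oracleQueries : ℝ) ^ 2 / pbThreshold F x r c k) := by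
        rw [Finset.sum_const, Finset.card_range, nsmul_eq_mul]

/-- **The bound `8T²/w` is the natural number `8T² · 2^k · (400·d·(r(n)+1))^c`** (`d = thm23Degree F x`), so
the machine's round budget is an explicit polynomial expression. [folklore] -/
theorem liveBound_eq :
    8 * ((F.circ x.length).oracleQueries : ℝ) ^ 2 / pbThreshold F x r c k =
      ((8 * (F.circ x.length).oracleQueries ^ 2 * 2 ^ k *
        (400 * thm23Degree F x * (r.eval x.length + 1)) ^ c : ℕ) : ℝ) := by
  have hd : (0 : ℝ) < thm23Degree F x := by
    have : 1 ≤ thm23Degree F x := by unfold thm23Degree; omega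
    exact_mod_cast this
  have hR : (0 : ℝ) < ((r.eval x.length : ℕ) : ℝ) + 1 := by positivity
  have hinner : (((1 / 10 : ℝ) ^ 2 * (1 / (((r.eval x.length : ℕ) : ℝ) + 1))) / 2) / 2 / (thm23Degree F x : ℝ) =
      1 / (400 * (thm23Degree F x : ℝ) * (((r.eval x.length : ℕ) : ℝ) + 1)) := by
    field_simp
    ring
  rw [div_eq_iff (pbThreshold_pos F x r c k).ne']
  unfold pbThreshold
  rw [hinner, one_div_pow, one_div_mul_one_div, mul_one_div]
  push_cast
  field_simp

end LiveBound

end SimTreePB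

end Summit.QuantumAdvantage.QuantumAdvantage.Cruxes.TransferPB.Birth

end
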